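import Mathlib
import Summits.ValiantsHypothesis.ValiantsHypothesis.Theorems.SymmetroidPencilBasics
import Summits.ValiantsHypothesis.ValiantsHypothesis.Theorems.KPlusLogSqLawMixedGaugeBiCoordAllRatios

/-!
# Route «KPlusLogSqLaw», `WeakLifting` (stmt-ValiantsHypothesis-19561) — mixed-gauge series: the two-class law `ζ ≤ n + 2m`
# does NOT survive two fast scales of ratio four — an explicit `(n, m) = (1, 2)` vertex gauge with speeds `a = 1 < b = (2, 8)` and SIX positive roots

HONEST FRAMING.  Helper file (hand leafhand-val-kpluslogsqlaw-1 g15, 2026-08-31; `--supports stmt-ValiantsHypothesis-19561 --as helper`,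
zero crux / stub credit; nothing here is about `WeakLifting` / `TropicalB` in their windows, the registered stubs of `tower_graft.lean`,
the doors, `MatrixDescartes` (stmt-ValiantsHypothesis-18050) or VP ≠ VNP).  It DECIDES the cell left open by hand g14's final census
(«mixed gauge — fast speeds NOT within a factor two: OPEN; new idea needed for the downward half»): the located two-class law of
val-sym-lift-p4 g26 / hand g14,
  `#{x > 0 : det [[A + diag(x^{aᵢ}), B], [Bᵀ, C − diag(x^{b_l})]] = 0} ≤ n + 2m`,
proved in the tree for ONE fast speed at every ratio (`card_posRoots_det_blockPencil_le_all`, p834386; several slow speeds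
`card_posRoots_det_coordBlockPencil_le`, p835068) and for several fast speeds WITHIN A FACTOR TWO (`card_posRoots_det_biCoordBlockPencil_le`,
p835238: `aᵢ < β < b_l < 2β`), is FALSE without the factor-two hypothesis:

* `six_le_card_posRoots_twoFastScales_witness` — for `n = 1`, `m = 2`, `a = (1)`, `b = (2, 8)` and the rational symmetric letter
  `M₀ = [[−127/100, 17/10, −21/10], [17/10, 349/50, −907/50], [−21/10, −907/50, 2191/50]]` (blocks `A = (−127/100)`, `B = (17/10, −21/10)`,
  `C = [[349/50, −907/50], [−907/50, 2191/50]]`), `det M(x) = x¹¹ − (127/100)x¹⁰ − (349/50)x⁹ + (58773/5000)x⁸ − (2191/50)x³ + (300307/5000)x²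
  − (5799/250)x + 38923/25000` (`det_twoFastScales_witness`) alternates in sign at `x = 1/32, 1/4, 23/32, 1, 25/16, 7/4, 2`, so the pencil has
  at least `6 = n + 2m + 1` distinct positive roots (exactly 6 by Descartes: the coefficient sequence has 6 sign changes — not typed);
* `not_blockPencil_law_all_speeds` — hence the law `≤ n + 2m` quantified over ALL speed configurations `1 ≤ aᵢ < b_l` fails (stated in
  the currency of `card_posRoots_det_biCoordBlockPencil_le` with the hypotheses `β`, `b_l < 2β` dropped).

HOW IT WAS FOUND (located part, this hand; scratch/abstract_down.py, build_cex.py): by the inertia telescope of the series the law is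
equivalent to the DOWNWARD LAW «at most `m` downward kernel directions over all positive roots»; for distinct simple roots the downward
law is the infeasibility of an abstract Gram system (pairwise two-point identities `Σᵢ Δ[y^{aᵢ}] wᵢwᵢ' = Σ_l Δ[y^{b_l}] q_l q_l'` + diagonal
downward inequalities), and a symmetric letter realising any feasible point exists iff the two-point identities hold (`M₀ = −V U⁻¹`).
Random sampling finds the system INFEASIBLE at fast-speed ratios `r = b₂/b₁ ∈ {1.8, 2.5, 3}` (0 of 2·10⁵) and FEASIBLE at `r = 4, 8`
(a handful per 2·10⁵), matching Bhatia–Sano (Loewner matrices of `y^r` are conditionally negative exactly for `r ∈ [1, 2]`, conditionally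
positive for `r ∈ [2, 3]`); every feasible point at `r = 4` realised gave `ν(M₀) = 2` and SIX roots.  So the boundary of the `n + 2m` law in
the fast-speed ratio lies in `(3, 4]` (located, not claimed); the census shape for two fast scales starts at `n + 2m + 1`.
[folklore: intermediate value theorem on an explicit rational certificate; the law and its currency are the cell's]
-/

set_option linter.dupNamespace false
set_option autoImplicit false

namespace Summit.ValiantsHypothesis.ValiantsHypothesis.Theorems.KPlusLogSqLaw

namespace MixedGauge

open Matrix Polynomial
open Summit.ValiantsHypothesis.ValiantsHypothesis.Theorems.SymmetroidDescartes (le_card_posRoots_of_alternating)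

/-- Determinant of a `(Fin 1 ⊕ Fin 2)`-indexed block matrix in closed form (reindex to `Fin 3`, rule of Sarrus). [folklore] -/
theorem det_fromBlocks_one_two {R : Type*} [CommRing R] (A : Matrix (Fin 1) (Fin 1) R) (B : Matrix (Fin 1) (Fin 2) R)
    (C : Matrix (Fin 2) (Fin 1) R) (D : Matrix (Fin 2) (Fin 2) R) :
    (Matrix.fromBlocks A B C D).det =
      A 0 0 * D 0 0 * D 1 1 - A 0 0 * D 0 1 * D 1 0 - B 0 0 * C 0 0 * D 1 1 + B 0 0 * D 0 1 * C 1 0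
        + B 0 1 * C 0 0 * D 1 0 - B 0 1 * D 0 0 * C 1 0 := by
  rw [← Matrix.det_reindex_self finSumFinEquiv, Matrix.det_fin_three]
  have h0 : (finSumFinEquiv.symm (0 : Fin 3) : Fin 1 ⊕ Fin 2) = Sum.inl 0 := by decide
  have h1 : (finSumFinEquiv.symm (1 : Fin 3) : Fin 1 ⊕ Fin 2) = Sum.inr 0 := by decide
  have h2 : (finSumFinEquiv.symm (2 : Fin 3) : Fin 1 ⊕ Fin 2) = Sum.inr 1 := by decide
  simp only [Matrix.reindex_apply, Matrix.submatrix_apply, h0, h1, h2, Matrix.fromBlocks_apply₁₁,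
    Matrix.fromBlocks_apply₁₂, Matrix.fromBlocks_apply₂₁, Matrix.fromBlocks_apply₂₂]

/-- **The witness pencil in closed form.**  For the blocks `A = (−127/100)`, `B = (17/10, −21/10)`, `C = [[349/50, −907/50], [−907/50, 2191/50]]`
and speeds `a = (1)`, `b = (2, 8)`: `det [[A + x, B], [Bᵀ, C − diag(x², x⁸)]]` is the displayed degree-11 polynomial. [folklore] -/
theorem det_twoFastScales_witness (x : ℝ) :
    (Matrix.fromBlocks ((!![(-127/100 : ℝ)]) + Matrix.diagonal (fun i => x ^ (![1] : Fin 1 → ℕ) i))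
        (!![(17/10 : ℝ), -21/10]) (!![(17/10 : ℝ), -21/10])ᵀ
        ((!![(349/50 : ℝ), -907/50; -907/50, 2191/50]) - Matrix.diagonal (fun l => x ^ (![2, 8] : Fin 2 → ℕ) l))).det
      = x ^ 11 - 127/100 * x ^ 10 - 349/50 * x ^ 9 + 58773/5000 * x ^ 8 - 2191/50 * x ^ 3 + 300307/5000 * x ^ 2
          - 5799/250 * x + 38923/25000 := by
  rw [det_fromBlocks_one_two]
  simp [Matrix.add_apply, Matrix.sub_apply, Matrix.diagonal_apply_eq, Matrix.diagonal_apply_ne, Matrix.transpose_apply]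
  ring

/-- the closed form as a function (local abbreviation inside proofs only). -/
private theorem witness_poly_eval (x : ℝ) :
    (Matrix.det (Matrix.fromBlocks ((!![(-127/100 : ℝ)]).map Polynomial.C + Matrix.diagonal (fun i => (Polynomial.X : Polynomial ℝ) ^ (![1] : Fin 1 → ℕ) i))
        ((!![(17/10 : ℝ), -21/10]).map Polynomial.C) ((!![(17/10 : ℝ), -21/10])ᵀ.map Polynomial.C)
        ((!![(349/50 : ℝ), -907/50; -907/50, 2191/50]).map Polynomial.C
          - Matrix.diagonal (fun l => (Polynomial.X : Polynomial ℝ) ^ (![2, 8] : Fin 2 → ℕ) l)))).eval x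
      = x ^ 11 - 127/100 * x ^ 10 - 349/50 * x ^ 9 + 58773/5000 * x ^ 8 - 2191/50 * x ^ 3 + 300307/5000 * x ^ 2
          - 5799/250 * x + 38923/25000 := by
  rw [← Polynomial.coe_evalRingHom, RingHom.map_det, eval_biCoordBlockPencil, det_twoFastScales_witness]

/-- **SIX positive roots with two fast scales of ratio four.**  The mixed vertex gauge with `n = 1` slow mode of speed `1` and `m = 2` fast
modes of speeds `2, 8` on the rational letter `M₀` above has at least `6 = n + 2m + 1` distinct positive roots of its determinant: the closed
form alternates in sign at `1/32 < 1/4 < 23/32 < 1 < 25/16 < 7/4 < 2` (intermediate value theorem, `le_card_posRoots_of_alternating`).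
[folklore] -/
theorem six_le_card_posRoots_twoFastScales_witness :
    6 ≤ ((Matrix.det (Matrix.fromBlocks ((!![(-127/100 : ℝ)]).map Polynomial.C
            + Matrix.diagonal (fun i => (Polynomial.X : Polynomial ℝ) ^ (![1] : Fin 1 → ℕ) i))
          ((!![(17/10 : ℝ), -21/10]).map Polynomial.C) ((!![(17/10 : ℝ), -21/10])ᵀ.map Polynomial.C)
          ((!![(349/50 : ℝ), -907/50; -907/50, 2191/50]).map Polynomial.C
            - Matrix.diagonal (fun l => (Polynomial.X : Polynomial ℝ) ^ (![2, 8] : Fin 2 → ℕ) l)))).roots.toFinset.filter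
        (fun x => 0 < x)).card := by
  refine le_card_posRoots_of_alternating _ 6 (![1/32, 1/4, 23/32, 1, 25/16, 7/4, 2]) ?_ ?_ ?_
  · refine Fin.strictMono_iff_lt_succ.mpr ?_
    intro j
    fin_cases j <;> simp <;> norm_num
  · intro j
    fin_cases j <;> simp
  · intro j
    rw [witness_poly_eval, witness_poly_eval]
    fin_cases j <;> simp <;> norm_num

/-- **The two-class mixed-gauge law does not extend to all speed configurations.**  The statement «for all `n, m`, symmetric `A, C`, any
`B`, and natural speeds `1 ≤ aᵢ < b_l`, the pencil `[[A + diag(x^{aᵢ}), B], [Bᵀ, C − diag(x^{b_l})]]` has at most `n + 2m` distinct positive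
roots of its determinant» — i.e. `card_posRoots_det_biCoordBlockPencil_le` (p835238) with the separating scale `β` and the factor-two
hypothesis `b_l < 2β` dropped — is FALSE, by the `(1, 2)` witness with speeds `1 < 2, 8`. [folklore] -/
theorem not_blockPencil_law_all_speeds :
    ¬ (∀ (n m : ℕ) (A : Matrix (Fin n) (Fin n) ℝ), A.IsSymm → ∀ (C : Matrix (Fin m) (Fin m) ℝ), C.IsSymm →
        ∀ (B : Matrix (Fin n) (Fin m) ℝ) (a : Fin n → ℕ) (bv : Fin m → ℕ), (∀ i, 1 ≤ a i) → (∀ i l, a i < bv l) →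
        ((Matrix.det (Matrix.fromBlocks (A.map Polynomial.C + Matrix.diagonal (fun i => (Polynomial.X : Polynomial ℝ) ^ a i))
              (B.map Polynomial.C) (Bᵀ.map Polynomial.C)
              (C.map Polynomial.C - Matrix.diagonal (fun l => (Polynomial.X : Polynomial ℝ) ^ bv l)))).roots.toFinset.filter
            (fun x => 0 < x)).card ≤ n + 2 * m) := by
  intro h
  have hA : (!![(-127/100 : ℝ)]).IsSymm := Matrix.IsSymm.ext (fun i j => by fin_cases i; fin_cases j; rfl)
  have hC : (!![(349/50 : ℝ), -907/50; -907/50, 2191/50]).IsSymm :=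
    Matrix.IsSymm.ext (fun i j => by fin_cases i <;> fin_cases j <;> rfl)
  have h5 := h 1 2 (!![(-127/100 : ℝ)]) hA (!![(349/50 : ℝ), -907/50; -907/50, 2191/50]) hC (!![(17/10 : ℝ), -21/10])
    (![1]) (![2, 8]) (fun i => by fin_cases i; decide) (fun i l => by fin_cases i; fin_cases l <;> decide)
  have h6 := six_le_card_posRoots_twoFastScales_witness
  exact absurd (h6.trans h5) (by norm_num)

end MixedGauge

end Summit.ValiantsHypothesis.ValiantsHypothesis.Theorems.KPlusLogSqLaw
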